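import Summits.BirchSwinnertonDyer.BirchSwinnertonDyer.Theses.MordellShaFreeCut
import Summits.BirchSwinnertonDyer.BirchSwinnertonDyer.Theorems.MordellShaFreeCutAssembly
import Literature.NumberTheory.EllipticCurves.BSDSelmerCMPConverseRankOneProofs
import Literature.NumberTheory.EllipticCurves.LeadingTerm

/-! # Route `MordellShaFreeCut` (rung S2b) — the cut is a faithful conjunct split of the leaf: `leaf ⟹ crux B`
outright, `leaf ⟹ crux A` modulo Gross–Zagier–Kolyvagin, hence `leaf ↔ (crux A ∧ crux B)` modulo GZK

The route file's "Converse bookkeeping (stated for the tribunal, T1 conjunct reading)" paragraph, kernel-checked: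
with `leaf := rankOne_threeConverse_mordellCurve` (corank₃ Sel_{3^∞}(E_D) = 1 ⟹ ord_{s=1} L(E_D,s) = 1, E_D : y² = x³ + D),
`A := RankPosOfThreeSelmerCorankOne`, `B := AnalyticRankOneOfRankOneFiniteShaThree`:
* `B` follows from the leaf outright — `rank = 1 ∧ #Ш[3^∞] < ∞ ⟹ corank₃ = 1` is Greenberg's identity, the tree
  theorem `selmerCorank_eq_one_of_mordellWeilRank_eq_one_of_finite`;
* `A` follows from the leaf granted Gross–Zagier–Kolyvagin as printed (tree HYPOTHESIS
  `rank_eq_analyticRank_of_analyticRank_le_one`, bsd.S17): `corank₃ = 1 ⟹ r_an = 1 ⟹ rank = r_an = 1`;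
* together with the route's `Assembly` (tree theorem `MordellShaFreeCutAssembly.assembly_holds`: `A → B → leaf`),
  `leaf ↔ (A ∧ B)` modulo GZK — neither conjunct is a residual import, and the pair is exactly the leaf's content.
Pure logic over tree theorems and ONE refereed named fact (GZK) carried as a binder; supports the route, closes nothing. -/

namespace Summit.BirchSwinnertonDyer.BirchSwinnertonDyer.Theorems.MordellShaFreeCutLeafConverse

open Literature.NumberTheory.EllipticCurves WeierstrassCurve
open Summit.BirchSwinnertonDyer.BirchSwinnertonDyer.Theses.MordellShaFreeCut

/-- **The cut is faithful: `leaf ↔ (crux A ∧ crux B)` modulo Gross–Zagier–Kolyvagin** (`hGZK`: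
`r_an ≤ 1 ⟹ rank = r_an ∧ Ш finite`, the refereed named fact `rank_eq_analyticRank_of_analyticRank_le_one`).
Forward: leaf ⟹ crux B OUTRIGHT (Greenberg's corank identity, tree theorem
`selmerCorank_eq_one_of_mordellWeilRank_eq_one_of_finite`, turns `rank = 1 ∧ #Ш[3^∞] < ∞` into `corank = 1`),
and leaf ⟹ crux A granted GZK (`corank = 1 ⟹ r_an = 1 ⟹ rank = r_an = 1 ≥ 1`); backward: the route's
`Assembly` (`MordellShaFreeCutAssembly.assembly_holds`). Deliberately stated ONLY as an `↔` with the leaf on the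
left: the two forward implications take the rung LEAF as hypothesis and are converse bookkeeping, not
progress on the crux items (no theorem of this file has a route decl as its type). -/
theorem leaf_iff_cruxes_of_gzk (hGZK : rank_eq_analyticRank_of_analyticRank_le_one) :
    rankOne_threeConverse_mordellCurve ↔
      (Summit.BirchSwinnertonDyer.BirchSwinnertonDyer.Theses.MordellShaFreeCut.RankPosOfThreeSelmerCorankOne ∧
        Summit.BirchSwinnertonDyer.BirchSwinnertonDyer.Theses.MordellShaFreeCut.AnalyticRankOneOfRankOneFiniteShaThree) := by
  refine ⟨fun hleaf => ⟨?_, ?_⟩, fun h => MordellShaFreeCutAssembly.assembly_holds h.1 h.2⟩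
  · -- leaf ⟹ crux A, granted GZK
    intro D hD hcorank
    haveI := isElliptic_mordellCurve hD
    have h1 : (mordellCurve D).analyticRank = 1 := hleaf hD hcorank
    have h2 : (mordellCurve D).mordellWeilRank = (mordellCurve D).analyticRank :=
      (hGZK (mordellCurve D) (by rw [h1])).1
    omega
  · -- leaf ⟹ crux B, outright
    intro D hD hrank hsha
    haveI := isElliptic_mordellCurve hD
    exact hleaf hD (selmerCorank_eq_one_of_mordellWeilRank_eq_one_of_finite _ 3 hrank hsha)

end Summit.BirchSwinnertonDyer.BirchSwinnertonDyer.Theorems.MordellShaFreeCutLeafConverse
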